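import Summits.CriticalPhenomena.SAWScalingLimit.Theorems.SAWDevelopingMapObservableToSLETypeLadderCarvedReductionSqueezeBulkPath
import HarnessLib

/-!
# The bulk path from EVENTUAL level data (piece (T-A′₂ path-ev) of stub T-A′₂
# `stub_carvedReduction_squeezeGeometry_domainsCore`)

Crux `SAWDevelopingMap.ObservableToSLE` (stmt-CriticalPhenomena-10472), line `six-class-type-ladder`,
stub T-A′₂ `stub_carvedReduction_squeezeGeometry_domainsCore`.  Landing target:
`Summits/CriticalPhenomena/SAWScalingLimit/Theorems/SAWDevelopingMapObservableToSLETypeLadderCarvedReductionSqueezeBulkPathEv.lean`.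

`TypeLadder.bulkPath_joinedIn` (piece BulkPath, p150788) asks the exact windows of radius `ρ` for
the removed level `U j = S ∪ T`, the window balls inside the domain and the wide link at EVERY
level.  In T-A′₂ the first holds only EVENTUALLY (the other family's hexagons stay off the window
ball once the pinned roots are `> 2R + ρ` apart).  `bulkPath_joinedIn_of_eventually` is the same
statement with all level data eventual: shift the sequences past a common good index.
Registered carrier: `stub_carvedReduction_bulkPathEv`.
-/

noncomputable section

open scoped Topology
open Filter Set Metric
open Literature.Probability.LatticeModels (HexVertex hexGraph hexCenter triEmbed Site)
open Literature.Probability.RandomPlanarGeometry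

namespace Summit.CriticalPhenomena.SAWScalingLimit.Theorems.ObservableToSLE.TypeLadder

open Summit.CriticalPhenomena.SAWScalingLimit.Theorems.ObservableToSLER.NestedGate

/-- **THE BULK PATH BETWEEN THE WINDOWS, from eventual level data.** -/
theorem bulkPath_joinedIn_of_eventually {s : ℕ → ℝ} {y : ℕ → Site 2} {U : ℕ → Set HexVertex}
    {q q' : ℕ → HexVertex} {Ω₀ X : Set ℂ} {ρ : ℝ} {τ P₀ P₁ : ℂ} (hρ : 0 < ρ) (hs : ∀ j, 0 < s j)
    (hs0 : Tendsto s atTop (𝓝 0)) (hτ : Tendsto (fun j => (s j : ℂ) * triEmbed (y j)) atTop (𝓝 τ))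
    (hq2 : ∀ j, (q j).2 = 0) (hq2' : ∀ j, (q' j).2 = 0)
    (hwin : ∀ᶠ j in atTop, ∀ v : HexVertex, (s j : ℂ) * hexCenter v ∈ ball ((s j : ℂ) * hexCenter (q j)) ρ →
      (v ∈ U j ↔ v.1 1 < (q j).1 1))
    (hwin' : ∀ᶠ j in atTop, ∀ v : HexVertex, (s j : ℂ) * hexCenter v ∈ ball ((s j : ℂ) * hexCenter (q' j)) ρ →
      (v ∈ U j ↔ v.1 1 < (q' j).1 1))
    (hball : ∀ᶠ j in atTop, closedBall ((s j : ℂ) * hexCenter (q j)) ρ ⊆ Ω₀)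
    (hball' : ∀ᶠ j in atTop, closedBall ((s j : ℂ) * hexCenter (q' j)) ρ ⊆ Ω₀)
    (hlink : ∀ᶠ j in atTop, WideLink Ω₀ (s j) ρ (U j) (q j) (q' j))
    (hconv : Tendsto (fun j => (s j : ℂ) * hexCenter (q j) - (s j : ℂ) * triEmbed (y j)) atTop (𝓝 P₀))
    (hconv' : Tendsto (fun j => (s j : ℂ) * hexCenter (q' j) - (s j : ℂ) * triEmbed (y j)) atTop (𝓝 P₁))
    (hX : ∀ᶠ j in atTop, ∀ z ∈ X, ∃ v ∈ U j,
      dist ((s j : ℂ) * hexCenter v - (s j : ℂ) * triEmbed (y j)) z < ρ / 32) :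
    JoinedIn (((fun z => z - τ) '' Ω₀) \ X) (P₀ + ((ρ / 4 : ℝ) : ℂ) * Complex.I)
      (P₁ + ((ρ / 4 : ℝ) : ℂ) * Complex.I) := by
  obtain ⟨j₀, hj₀⟩ := eventually_atTop.1 (hwin.and (hwin'.and (hball.and (hball'.and hlink))))
  have hsh : Tendsto (fun j => j + j₀) atTop atTop := tendsto_add_atTop_nat j₀
  exact bulkPath_joinedIn (s := fun j => s (j + j₀)) (y := fun j => y (j + j₀)) (U := fun j => U (j + j₀))
    (q := fun j => q (j + j₀)) (q' := fun j => q' (j + j₀)) hρ (fun j => hs _) (hs0.comp hsh) (hτ.comp hsh)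
    (fun j => hq2 _) (fun j => hq2' _) (fun j => (hj₀ _ (Nat.le_add_left _ _)).1)
    (fun j => (hj₀ _ (Nat.le_add_left _ _)).2.1) (fun j => (hj₀ _ (Nat.le_add_left _ _)).2.2.1)
    (fun j => (hj₀ _ (Nat.le_add_left _ _)).2.2.2.1) (fun j => (hj₀ _ (Nat.le_add_left _ _)).2.2.2.2)
    (hconv.comp hsh) (hconv'.comp hsh) (hsh.eventually hX)

/-- **Registered carrier `stub_carvedReduction_bulkPathEv`** (crux item stmt-CriticalPhenomena-10472,
stub T-A′₂ `stub_carvedReduction_squeezeGeometry_domainsCore`, piece THE BULK PATH FROM EVENTUAL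
LEVEL DATA): registry form of `bulkPath_joinedIn_of_eventually`. -/
theorem stub_carvedReduction_bulkPathEv :
    ∀ (s : ℕ → ℝ) (y : ℕ → Site 2) (U : ℕ → Set HexVertex) (q q' : ℕ → HexVertex) (Ω₀ X : Set ℂ)
      (ρ : ℝ) (τ P₀ P₁ : ℂ), 0 < ρ → (∀ j, 0 < s j) → Tendsto s atTop (𝓝 0) →
      Tendsto (fun j => (s j : ℂ) * triEmbed (y j)) atTop (𝓝 τ) →
      (∀ j, (q j).2 = 0) → (∀ j, (q' j).2 = 0) →
      (∀ᶠ j in atTop, ∀ v : HexVertex, (s j : ℂ) * hexCenter v ∈ ball ((s j : ℂ) * hexCenter (q j)) ρ →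
        (v ∈ U j ↔ v.1 1 < (q j).1 1)) →
      (∀ᶠ j in atTop, ∀ v : HexVertex, (s j : ℂ) * hexCenter v ∈ ball ((s j : ℂ) * hexCenter (q' j)) ρ →
        (v ∈ U j ↔ v.1 1 < (q' j).1 1)) →
      (∀ᶠ j in atTop, closedBall ((s j : ℂ) * hexCenter (q j)) ρ ⊆ Ω₀) →
      (∀ᶠ j in atTop, closedBall ((s j : ℂ) * hexCenter (q' j)) ρ ⊆ Ω₀) →
      (∀ᶠ j in atTop, WideLink Ω₀ (s j) ρ (U j) (q j) (q' j)) →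
      Tendsto (fun j => (s j : ℂ) * hexCenter (q j) - (s j : ℂ) * triEmbed (y j)) atTop (𝓝 P₀) →
      Tendsto (fun j => (s j : ℂ) * hexCenter (q' j) - (s j : ℂ) * triEmbed (y j)) atTop (𝓝 P₁) →
      (∀ᶠ j in atTop, ∀ z ∈ X, ∃ v ∈ U j,
        dist ((s j : ℂ) * hexCenter v - (s j : ℂ) * triEmbed (y j)) z < ρ / 32) →
      JoinedIn (((fun z => z - τ) '' Ω₀) \ X) (P₀ + ((ρ / 4 : ℝ) : ℂ) * Complex.I)
        (P₁ + ((ρ / 4 : ℝ) : ℂ) * Complex.I) :=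
  fun _ _ _ _ _ _ _ _ _ _ _ hρ hs hs0 hτ hq2 hq2' hwin hwin' hball hball' hlink hconv hconv' hX =>
    bulkPath_joinedIn_of_eventually hρ hs hs0 hτ hq2 hq2' hwin hwin' hball hball' hlink hconv hconv' hX

end Summit.CriticalPhenomena.SAWScalingLimit.Theorems.ObservableToSLE.TypeLadder

end
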